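import Mathlib
import Summits.ValiantsHypothesis.ValiantsHypothesis.Theorems.GrenetZeonTwoDimCoefficientsGradedHessianRate
import Summits.ValiantsHypothesis.ValiantsHypothesis.Theorems.GrenetZeonTwoDimCoefficientsScalingPermPointHessian
import Summits.ValiantsHypothesis.ValiantsHypothesis.Theorems.GrenetZeonTwoDimCoefficientsDualUnipotentRankTransfer

/-!
# Crux `GrenetZeon.TwoDimCoefficients` (stmt-ValiantsHypothesis-8062) / rung `DualUnipotentThreeHalves` (stmt-24318):
# ★★★ the 3/2 RUNG for consecutive-GRADED unipotent dual representations of ANY nil-index (kernel plan step 5b)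

Memo TWENTY-SECOND HAND §2, Corollary.  In the normal form `per_n = tr(N^{n−1}·M)` (✓ `exists_nilpotent_pencil_of_dualUnipotentRepr`,
`N`, `M` linear `m × m`), if `N` is consecutive-level graded for some `lvl : Fin m → ℕ` (`N a b ≠ 0 ⇒ lvl b = lvl a + 1`) — the
graded / layered / block-path representations, of ARBITRARY length (nil-index) — then

  `n³ ≤ 51·m²`   (`n ≥ 4`).

Proof: ✓ Theorem T7 `rank_hess0_graded_mul_le` at the identity permutation point, where `rank Hess per_n = n²`
(✓ `rank_hess0_transl_permPoint_perPoly`), and `n − 1 < m` (else `N^{n−1} = 0`).  UNCONDITIONAL for this class: no per-genericity,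
no substitution, no index-cost or Hessian-rate hypothesis.

* ★★★ `cube_le_of_graded_tracePow` — the rung above.

HONEST FRAMING: the 24318 decl for GENERAL pencils (block-triangular with non-zero diagonal classes, long jumps, wild constituents),
the stub `stub_longMassSlowLawInv`, crux 8062 and `VP ≠ VNP` remain open; this closes no stub by name.

References: T. Mignon, N. Ressayre, Int. Math. Res. Not. 2004:79, Thm. 1.1 (via the tree); folklore.
-/

set_option linter.dupNamespace false
set_option autoImplicit false

noncomputable section

namespace Summit.ValiantsHypothesis.ValiantsHypothesis.Theorems.GrenetZeonTwoDimCoefficients.GradedThreeHalves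

open Module Matrix MvPolynomial
open Literature.Computability.AlgebraicComplexity
open Summit.ValiantsHypothesis.ValiantsHypothesis.Cruxes.TwoDimCoefficients.DimTwoCases (AffMat IsAffine perPoly_ne_C)
open Summit.ValiantsHypothesis.ValiantsHypothesis.Theorems.GrenetZeonTwoDimCoefficients.GradedTopTrace
  (pow_eq_zero_of_graded)
open Summit.ValiantsHypothesis.ValiantsHypothesis.Theorems.GrenetZeonTwoDimCoefficients.GradedHessianRate
  (rank_hess0_graded_mul_le)
open Summit.ValiantsHypothesis.ValiantsHypothesis.Theorems.GrenetZeonTwoDimCoefficients.ScalingClosure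
  (rank_hess0_transl_permPoint_perPoly)

variable {n m : ℕ}

/-- ★★★ **The 3/2 rung for consecutive-graded representations of any nil-index.**  If `per_n = tr(N^{n−1}·M)` with `N`, `M`
linear `m × m` and `N` consecutive-level graded for `lvl`, then `n³ ≤ 51·m²` (`n ≥ 4`).
[cite: MignonRessayre2004, Thm. 1.1 — via the tree; folklore] -/
theorem cube_le_of_graded_tracePow (hn : 4 ≤ n) (lvl : Fin m → ℕ) (N M : AffMat n m)
    (hN : ∀ i j, (N i j).IsHomogeneous 1) (hM : ∀ i j, (M i j).IsHomogeneous 1)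
    (hgr : ∀ a b, lvl b ≠ lvl a + 1 → N a b = 0)
    (hper : perPoly (Fin n) ℂ = (N ^ (n - 1) * M).trace) :
    n ^ 3 ≤ 51 * m ^ 2 := by
  classical
  -- `n − 1 < m`: otherwise `N^{n−1} = 0` and the permanent would vanish
  have hnm : n - 1 < m := by
    by_contra h
    have hNm : N ^ m = 0 := pow_eq_zero_of_graded lvl N hgr
    have hN0 : N ^ (n - 1) = 0 := by
      obtain ⟨d, hd⟩ := Nat.exists_eq_add_of_le (not_lt.mp h)
      rw [hd, pow_add, hNm, Matrix.zero_mul]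
    apply perPoly_ne_C (n := n) (by omega) 0
    rw [hper, hN0, Matrix.zero_mul, Matrix.trace_zero, map_zero]
  have hA : IsAffine N := fun i j => (hN i j).totalDegree_le
  have hB : IsAffine M := fun i j => (hM i j).totalDegree_le
  -- T7 at the identity permutation point
  set z : Fin n × Fin n → ℂ := fun u => if u.1 = (1 : Equiv.Perm (Fin n)) u.2 then (1 : ℂ) else 0 with hz
  have hrate := rank_hess0_graded_mul_le lvl N M hA hB hgr hn hnm z
  rw [← hper, rank_hess0_transl_permPoint_perPoly (by omega) 1] at hrate
  -- arithmetic: `n² · ⌊n/4⌋ ≤ 12 m²`, `n ≤ 4⌊n/4⌋ + 3`, `n ≤ m`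
  have h4 : n ≤ 4 * (n / 4) + 3 := by omega
  have hnm' : n ≤ m := by omega
  have hsq : n ^ 2 ≤ m ^ 2 := Nat.pow_le_pow_left hnm' 2
  calc n ^ 3 = n * n ^ 2 := by ring
    _ ≤ (4 * (n / 4) + 3) * n ^ 2 := Nat.mul_le_mul_right _ h4
    _ = 4 * (n ^ 2 * (n / 4)) + 3 * n ^ 2 := by ring
    _ ≤ 4 * (12 * m ^ 2) + 3 * m ^ 2 := by gcongr
    _ = 51 * m ^ 2 := by ring

end Summit.ValiantsHypothesis.ValiantsHypothesis.Theorems.GrenetZeonTwoDimCoefficients.GradedThreeHalves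

end
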